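import Mathlib
import Summits.ValiantsHypothesis.ValiantsHypothesis.Theses.LiouvilleSarnak
import Summits.ValiantsHypothesis.ValiantsHypothesis.Theorems.LiouvilleSarnakDigitalBilinearLiouvilleTtStarTransfer

/-!
# Route LiouvilleSarnak — crux `DigitalBilinearLiouville` (stmt-ValiantsHypothesis-14774):
# THE CRUX IS THE DIGITAL FOUR-POINT (BOX) CHOWLA STATEMENT AT FULL SCALE

`Theorems/LiouvilleSarnakDigitalBilinearLiouvilleTtStarTransfer.lean` proved the crux equivalent to
the open stub `stub_twoPointDigital` of line `tt_star`: for all large `n` and every balanced cut `π`,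
`Σ_{r,r'} ‖Σ_c λ(m_{rc}) λ(m_{r'c})‖² ≤ ε 16^n` (`m_{rc} = N_π(r, c) + 1`).  Expanding the square, this
file states the crux BY NAME as a FOUR-POINT correlation statement:

* ★ `digitalBilinearLiouville_iff_fourPointDigital` —
  `DigitalBilinearLiouville ⟺ ∀ ε > 0, ∀ᶠ n, ∀ π,
   Σ_{r, r', c, c'} λ(m_{rc}) λ(m_{r'c}) λ(m_{rc'}) λ(m_{r'c'}) ≤ ε 16^n`:
  `o(1)` cancellation in the sum of `λ` over ALL `16^n` DIGITAL PARALLELOGRAMS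
  `(m, m + d_R, m + d_C, m + d_R + d_C)` of the cut (a box / `U²`-type norm relative to the digit
  splitting `π`, with row shifts `d_R` and column shifts `d_C` as large as the range `4^n`).

Reading, next to the crux `LiouvilleCutRank` (stmt-14775).  Both cruxes are now four-point
statements, and the gap between them is exactly visible:
`Theorems/LiouvilleSarnakLiouvilleCutRankFourPointLogChowla.lean` derives `LiouvilleCutRank` from the
`k = 4` case of the LOGARITHMICALLY AVERAGED Chowla conjecture along the progressions
`n ≡ b (mod 4^ℓ)` with FIXED shifts inside one block (the first open case of a mainstream conjecture;
`k = 2` is Tao's theorem, proved in the tree, odd `k` is Tao–Teräväinen), whereas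
`DigitalBilinearLiouville` IS uniform four-point cancellation at full scale with shifts up to the
range — a statement no standard conjecture short of GRH-type hypotheses for digitally structured sums
is known to imply (tree: `…DigitalBilinearLiouvilleCoarseVectors`, `…PeriodicVectors` prove the
digit-blind classes unconditionally).

Honest framing: a reformulation (`‖Σ_c a_c‖² = Σ_{c,c'} a_c a_{c'}` for the real signs
`a_c = λ(m_{rc}) λ(m_{r'c})`); `DigitalBilinearLiouville` stays OPEN (HELD), and nothing here bears on
VP versus VNP.  No definitions.
-/

-- the directory `ValiantsHypothesis/ValiantsHypothesis` repeats the summit name (tree layout)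
set_option linter.dupNamespace false

namespace Summit.ValiantsHypothesis.ValiantsHypothesis.Theorems.LiouvilleSarnakDigitalBilinearLiouville.FourPointDigital

open Finset

open Summit.ValiantsHypothesis.ValiantsHypothesis.Theses.LiouvilleSarnak (DigitalBilinearLiouville)
open Summit.ValiantsHypothesis.ValiantsHypothesis.Theorems.LiouvilleSarnakDigitalBilinearLiouville.TtStar
  (digitalBilinearLiouville_iff_twoPointDigital)

/-- For integers `a_c`, `‖Σ_c (a_c : ℂ)‖² = Σ_{c, c'} a_c a_{c'}` (as real numbers). [folklore] -/
theorem norm_sum_intCast_sq {κ : Type*} [Fintype κ] (a : κ → ℤ) :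
    ‖∑ c, ((a c : ℤ) : ℂ)‖ ^ 2 = ∑ c, ∑ c', ((a c * a c' : ℤ) : ℝ) := by
  rw [← Int.cast_sum, Complex.norm_intCast, sq_abs]
  push_cast
  rw [sq, sum_mul_sum]

/-- ★ **`DigitalBilinearLiouville` ⟺ the digital four-point statement.**  The crux holds iff for every
`ε > 0`, all large `n` and every balanced cut `π` of the `2n` bit positions, the sum of
`λ(m_{rc}) λ(m_{r'c}) λ(m_{rc'}) λ(m_{r'c'})` over ALL quadruples `(r, r', c, c')`
(`m_{rc} = N_π(r, c) + 1`; the `16^n` digital parallelograms of the cut, degenerate ones included) is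
`≤ ε · 16^n`.  Proof: `…TtStarTransfer.digitalBilinearLiouville_iff_twoPointDigital` and
`‖Σ_c a_c‖² = Σ_{c,c'} a_c a_{c'}` for the real signs `a_c = λ(m_{rc}) λ(m_{r'c})`. [folklore] -/
theorem digitalBilinearLiouville_iff_fourPointDigital :
    DigitalBilinearLiouville ↔
    ∀ ε : ℝ, 0 < ε → ∃ n₀ : ℕ, ∀ n ≥ n₀, ∀ π : Fin n ⊕ Fin n ≃ Fin (2 * n),
      (∑ r : Fin n → Bool, ∑ r' : Fin n → Bool, ∑ c : Fin n → Bool, ∑ c' : Fin n → Bool,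
        ((ArithmeticFunction.liouville
            (Nat.ofBits (fun j : Fin (2 * n) => Sum.elim r c (π.symm j)) + 1) *
          ArithmeticFunction.liouville
            (Nat.ofBits (fun j : Fin (2 * n) => Sum.elim r' c (π.symm j)) + 1) *
          (ArithmeticFunction.liouville
            (Nat.ofBits (fun j : Fin (2 * n) => Sum.elim r c' (π.symm j)) + 1) *
          ArithmeticFunction.liouville
            (Nat.ofBits (fun j : Fin (2 * n) => Sum.elim r' c' (π.symm j)) + 1)) : ℤ) : ℝ)) ≤
      ε * 16 ^ n := by
  rw [digitalBilinearLiouville_iff_twoPointDigital]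
  -- the two conditions agree termwise in `(r, r')`
  have hterm : ∀ (n : ℕ) (π : Fin n ⊕ Fin n ≃ Fin (2 * n)) (r r' : Fin n → Bool),
      ‖∑ c : Fin n → Bool,
          ((ArithmeticFunction.liouville
              (Nat.ofBits (fun j : Fin (2 * n) => Sum.elim r c (π.symm j)) + 1) : ℤ) : ℂ) *
          ((ArithmeticFunction.liouville
              (Nat.ofBits (fun j : Fin (2 * n) => Sum.elim r' c (π.symm j)) + 1) : ℤ) : ℂ)‖ ^ 2 =
      ∑ c : Fin n → Bool, ∑ c' : Fin n → Bool,
        ((ArithmeticFunction.liouville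
            (Nat.ofBits (fun j : Fin (2 * n) => Sum.elim r c (π.symm j)) + 1) *
          ArithmeticFunction.liouville
            (Nat.ofBits (fun j : Fin (2 * n) => Sum.elim r' c (π.symm j)) + 1) *
          (ArithmeticFunction.liouville
            (Nat.ofBits (fun j : Fin (2 * n) => Sum.elim r c' (π.symm j)) + 1) *
          ArithmeticFunction.liouville
            (Nat.ofBits (fun j : Fin (2 * n) => Sum.elim r' c' (π.symm j)) + 1)) : ℤ) : ℝ) := by
    intro n π r r'
    have h := norm_sum_intCast_sq (fun c : Fin n → Bool =>
      ArithmeticFunction.liouville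
          (Nat.ofBits (fun j : Fin (2 * n) => Sum.elim r c (π.symm j)) + 1) *
        ArithmeticFunction.liouville
          (Nat.ofBits (fun j : Fin (2 * n) => Sum.elim r' c (π.symm j)) + 1))
    simp only [Int.cast_mul] at h
    rw [h]
    push_cast
    rfl
  have hsum : ∀ (n : ℕ) (π : Fin n ⊕ Fin n ≃ Fin (2 * n)),
      (∑ r : Fin n → Bool, ∑ r' : Fin n → Bool, ‖∑ c : Fin n → Bool,
          ((ArithmeticFunction.liouville
              (Nat.ofBits (fun j : Fin (2 * n) => Sum.elim r c (π.symm j)) + 1) : ℤ) : ℂ) *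
          ((ArithmeticFunction.liouville
              (Nat.ofBits (fun j : Fin (2 * n) => Sum.elim r' c (π.symm j)) + 1) : ℤ) : ℂ)‖ ^ 2) =
      ∑ r : Fin n → Bool, ∑ r' : Fin n → Bool, ∑ c : Fin n → Bool, ∑ c' : Fin n → Bool,
        ((ArithmeticFunction.liouville
            (Nat.ofBits (fun j : Fin (2 * n) => Sum.elim r c (π.symm j)) + 1) *
          ArithmeticFunction.liouville
            (Nat.ofBits (fun j : Fin (2 * n) => Sum.elim r' c (π.symm j)) + 1) *
          (ArithmeticFunction.liouville
            (Nat.ofBits (fun j : Fin (2 * n) => Sum.elim r c' (π.symm j)) + 1) *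
          ArithmeticFunction.liouville
            (Nat.ofBits (fun j : Fin (2 * n) => Sum.elim r' c' (π.symm j)) + 1)) : ℤ) : ℝ) :=
    fun n π => sum_congr rfl fun r _ => sum_congr rfl fun r' _ => hterm n π r r'
  constructor
  · intro h ε hε
    obtain ⟨n₀, hn₀⟩ := h ε hε
    exact ⟨n₀, fun n hn π => (hsum n π) ▸ hn₀ n hn π⟩
  · intro h ε hε
    obtain ⟨n₀, hn₀⟩ := h ε hε
    exact ⟨n₀, fun n hn π => (hsum n π).symm ▸ hn₀ n hn π⟩

end Summit.ValiantsHypothesis.ValiantsHypothesis.Theorems.LiouvilleSarnakDigitalBilinearLiouville.FourPointDigital
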